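import Literature.MathematicalPhysics.QuantumFieldTheory.Balaban1983to89.B6SectACriticalPointV1

/-!
# `Balaban1983to89.B6MinimalOrbitV1` — T. Bałaban, *Propagators and renormalization transformations for lattice gauge
# theories. II*, Commun. Math. Phys. **96** (1984) 223–250 [Balaban1984PropagatorsII], Sect. A p. 224 ON THE V1
# MULTI-LEVEL TORUS CALCULUS: ***"We want to find a minimal orbit of the functional (2.5) under the restrictions (2.6). To
# solve this problem we have to fix a convenient gauge condition"*** — PROVED for the concrete lattice operators: the
# minimisers of (2.5) under (2.6) ALONE form EXACTLY ONE orbit of the gauge group (2.7), namely `HB + ∂N(Q′)` with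
# `HB = GQ*(QGQ*)⁻¹B` of (2.35); every orbit meets the gauge condition (2.12) `R∂*A = 0` in exactly one configuration; and
# (2.12) selects `HB` on the minimal orbit — every nested family of domains, every lattice factor `c ≠ 0`, every `B`

statement-level skeleton of published theorems with citation tags; proofs where landed; nothing here is a claim about the
Yang–Mills mass gap

PDF held: `paper:balaban1984-cmp96-propagators-rt-ii` (journal page = PDF page + 222); p. 224 read AS IMAGE on the ×2 render
`run/shared/lean/pub/pub-balaban/b2b-balaban-ref1/pages/1984-cmp96-propagators-rt-II/…-p002-x2.png` (this seat, 2026-08-21),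
pp. 225–228 on `…-p003…p006-x2.png`.

CITATION HEADER (lean-in-tree rule).  Cell `lit-balaban` (HOME `run/shared/lean/pub/lit-balaban/`), PHASE-2 proof seat **p21**
(gen 6), B6 fold owner r03, referee ref-4.  WHAT IS REPRODUCED: SKELETON rows **B6.Eq2.5** / **B6.Eq2.7** (the variational
problem (2.5)–(2.6), its invariance under (2.7), *"a minimal orbit"*), **B6.Eq2.8** / **B6.Eq2.12** (gauge fixing: each orbit
meets (2.12) exactly once) and **B6.Eq2.35** (*"which is of course, a minimum of the functional (2.5)"*, p. 226) — on the
CONCRETE V1 model of Sect. A built by this seat in gen 5 (`…B6SectADomainsV1` … `…B6SectACriticalPointV1`).  KIND model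
instance / completion: gen 5's `…B6SectACriticalPointV1.energy_hOp_le_V1` minimises (2.5) over the GAUGE-FIXED admissible set
((2.6) ∧ (2.12)); here the gauge condition is removed, as the text poses the problem.  Inputs BY NAME: r03's
`…B6Eq218Lagrangian.{energy, Admissible, IsCritical, energy_add, isCritical_of_isMinOn}` (p246073), `…B6SectA.hOp` (2.35),
gen 5's `…B6SectACriticalPointV1.{existsUnique_gauge212, isCritical_iff_eq_hOp, isCritical_hOp_V1, energy_hOp_le_V1,
QE_dE_eq_zero, dcE_comp_dE}`, `…B6SectAVectorModelV1.{GE, EE}`, `…B6SectAOperatorsV1.{dE, dsE, dcE, QE, QsE, QpE, RE, RE_fix,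
mem_ker_QpE_iff}`, `…B6SectAZeroModesV1.laplace_injOn_gaugeSpace`.  Nothing restated.

PRINT (p. 224, verbatim).  *"The variational problem can be formulated as follows. We consider the functional A → Σ_p
η^d|(∂A)(p)|² (2.5) for A fixed outside Ω₁ and with fixed averages inside Ω₁, more exactly A = B₀ on Λ₀, Q_jA = B_j on Λ_j,
j = 1, …, k. (2.6) The functional and the conditions are invariant with respect to gauge transformations λ: A → A^λ = A − ∂λ
such that λ = 0 on Λ₀, Q′_jλ = 0 on Λ_j, j = 1, …, k. (2.7) These gauge transformations form a group and we consider orbits of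
this group. We want to find a minimal orbit of the functional (2.5) under the restrictions (2.6). To solve this problem we
have to fix a convenient gauge condition. We will use a generalization of the gauge condition R∂*A = 0 … from each orbit of
the gauge group we choose a minimum of the functional (2.8)"*; p. 225: *"Thus the functional (2.8) has exactly one minimum on
each orbit. This minimum satisfies the equation R∂*A^{λ₀} = 0, or R∂*A = 0 if we take A^{λ₀} as A. (2.12)"*; p. 226: *"We will
prove that there exists exactly one critical configuration of the above variational problem with the additional condition
(2.12), which is of course, a minimum of the functional (2.5)"*; p. 228: *"A = HB = GQ*(QGQ*)⁻¹B. (2.35)"*.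

WHAT IS PROVED (0 sorry, 0 new named facts; axioms standard; every `D : Domains P`, lattice factor `c ≠ 0`, every `B`;
`HB := B6SectA.hOp G Q* (QGQ*)⁻¹ B` with gen 5's `G = GE`, `(QGQ*)⁻¹ = EE` at weights `w > 0`).  §1 the gauge group acts:
(2.5) and (2.6) are invariant under `A ↦ A − ∂λ`, `λ ∈ N(Q′)` (`energy_sub_dE` — in fact for every `λ` —, `QE_sub_dE`); the
orbit relation (`SameOrbit`, an equivalence relation).  §2 **gauge fixing**: every orbit meets the gauge condition (2.12) in
EXACTLY ONE configuration (`existsUnique_gaugeFixed_in_orbit`), and that configuration keeps (2.6) (`admissible_gaugeFix`).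
§3 **the minimal orbit**: `IsMin25` (minimiser of (2.5) under (2.6) alone); `energy_hOp_le_of_constr` (`‖∂(HB)‖² ≤ ‖∂A‖²` for
EVERY `A` with `QA = B` — the gauge condition of gen 5's `energy_hOp_le_V1` removed), `isMin25_hOp`; **`isMin25_iff_mem_orbit`:
`A` minimises (2.5) under (2.6) iff `A = HB + ∂λ` for some `λ ∈ N(Q′)`** — the minimisers form EXACTLY ONE ORBIT
(`exists_isMin25`, `sameOrbit_of_isMin25`, `isMin25_of_sameOrbit`); §4 (2.12) selects `HB` on it: **`existsUnique_isMin25_gauge`: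
`∃! A, IsMin25 B A ∧ R∂*A = 0`**, and it is `HB` (`isMin25_and_gauge_iff`).
-/

open scoped InnerProductSpace

namespace Literature.MathematicalPhysics.QuantumFieldTheory.Balaban1983to89.B6MinimalOrbitV1

open LatticeFieldCalculus B6SectADomainsV1 B6SectAZeroModesV1 B6SectAOntoV1 B6SectAOperatorsV1 B6SectAVectorModelV1
  B6SectACriticalPointV1
open BalabanImbrieJaffe1984to88.BIJ85AxialPropagator411 (BondSpace PlaqSpace)
open B6Eq218Lagrangian (IsCritical Admissible energy)

noncomputable section

variable {P : Params} (D : Domains P)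

/-! ## §1. The gauge group (2.7) acts on (2.5) and on (2.6) -/

/-- ***"The functional … [is] invariant with respect to gauge transformations"***: `‖∂(A − ∂λ)‖² = ‖∂A‖²` (for EVERY scalar `λ`:
`∂∂λ = 0`). [cite: Balaban1984PropagatorsII, (2.5)–(2.7) p.224] -/
theorem energy_sub_dE (c : ℝ) (x : BondSpace P) (n : ScalarSpace P) :
    energy (dcE c) (x - dE c n) = energy (dcE c) x := by
  have h : dcE c (dE c n) = 0 := by
    simpa using LinearMap.congr_fun (dcE_comp_dE (P := P) c) n
  simp only [energy, map_sub, h, sub_zero]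

/-- ***"… and the conditions are invariant"***: `Q(A − ∂λ) = QA` for `λ ∈ N(Q′)` (gen 5's Lemma S / (1.20)).
[cite: Balaban1984PropagatorsII, (2.6)–(2.7) p.224] -/
theorem QE_sub_dE (c : ℝ) (x : BondSpace P) {n : ScalarSpace P} (hn : n ∈ LinearMap.ker (QpE D)) :
    QE D (x - dE c n) = QE D x := by
  rw [map_sub, QE_dE_eq_zero D c n hn, sub_zero]

/-- **the orbit relation of the gauge group (2.7)**: `A′ = A − ∂λ` for some `λ ∈ N(Q′)` (*"These gauge transformations form a
group and we consider orbits of this group"*). [cite: Balaban1984PropagatorsII, (2.7) p.224] -/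
def SameOrbit (c : ℝ) (x y : BondSpace P) : Prop := ∃ n ∈ LinearMap.ker (QpE D), y = x - dE c n

/-- reflexive (`λ = 0`). [cite: Balaban1984PropagatorsII, (2.7) p.224] -/
theorem sameOrbit_refl (c : ℝ) (x : BondSpace P) : SameOrbit D c x x :=
  ⟨0, Submodule.zero_mem _, by rw [map_zero, sub_zero]⟩

/-- symmetric (`λ ↦ −λ`). [cite: Balaban1984PropagatorsII, (2.7) p.224] -/
theorem sameOrbit_symm (c : ℝ) {x y : BondSpace P} (h : SameOrbit D c x y) : SameOrbit D c y x := by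
  obtain ⟨n, hn, rfl⟩ := h
  exact ⟨-n, Submodule.neg_mem _ hn, by rw [map_neg, sub_neg_eq_add, sub_add_cancel]⟩

/-- transitive (`λ₁ + λ₂`): *"These gauge transformations form a group"*. [cite: Balaban1984PropagatorsII, (2.7) p.224] -/
theorem sameOrbit_trans (c : ℝ) {x y z : BondSpace P} (h₁ : SameOrbit D c x y) (h₂ : SameOrbit D c y z) :
    SameOrbit D c x z := by
  obtain ⟨n₁, hn₁, rfl⟩ := h₁
  obtain ⟨n₂, hn₂, rfl⟩ := h₂
  exact ⟨n₁ + n₂, Submodule.add_mem _ hn₁ hn₂, by rw [map_add, sub_sub]⟩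

/-- (2.5) is constant on orbits. [cite: Balaban1984PropagatorsII, (2.5)–(2.7) p.224] -/
theorem energy_eq_of_sameOrbit (c : ℝ) {x y : BondSpace P} (h : SameOrbit D c x y) :
    energy (dcE c) y = energy (dcE c) x := by
  obtain ⟨n, _, rfl⟩ := h
  exact energy_sub_dE c x n

/-- (2.6) is constant on orbits. [cite: Balaban1984PropagatorsII, (2.6)–(2.7) p.224] -/
theorem QE_eq_of_sameOrbit (c : ℝ) {x y : BondSpace P} (h : SameOrbit D c x y) : QE D y = QE D x := by
  obtain ⟨n, hn, rfl⟩ := h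
  exact QE_sub_dE D c x hn

/-! ## §2. Gauge fixing: every orbit meets (2.12) `R∂*A = 0` in exactly one configuration -/

/-- **every orbit meets the gauge condition (2.12) in EXACTLY ONE configuration** (*"from each orbit of the gauge group we
choose a minimum of the functional (2.8) … exactly one minimum on each orbit … R∂*A = 0 if we take A^{λ₀} as A"*; gen 5's
`existsUnique_gauge212` gives the unique `λ₀`, and `λ ↦ A − ∂λ` is injective on `N(Q′)`). [cite: Balaban1984PropagatorsII, (2.8) p.224 + (2.12) p.225] -/
theorem existsUnique_gaugeFixed_in_orbit {c : ℝ} (hc : c ≠ 0) (x : BondSpace P) :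
    ∃! y : BondSpace P, SameOrbit D c x y ∧ RE D c (dsE c y) = 0 := by
  obtain ⟨n₀, ⟨hn₀, hR₀⟩, huniq⟩ := existsUnique_gauge212 D hc x
  refine ⟨x - dE c n₀, ⟨⟨n₀, hn₀, rfl⟩, hR₀⟩, ?_⟩
  rintro y ⟨⟨n, hn, rfl⟩, hR⟩
  rw [huniq n ⟨hn, hR⟩]

/-- the gauge-fixed representative keeps (2.6): it is `Admissible` ((2.6) ∧ (2.12)) whenever `QA = B`.
[cite: Balaban1984PropagatorsII, (2.6) p.224 + (2.12) p.225] -/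
theorem admissible_gaugeFix {c : ℝ} (hc : c ≠ 0) {B : BondIdxSpace D} {x : BondSpace P} (hx : QE D x = B) :
    ∃ n ∈ LinearMap.ker (QpE D), Admissible (QE D) (dsE c) (RE D c) B (x - dE c n) := by
  obtain ⟨n₀, ⟨hn₀, hR₀⟩, -⟩ := existsUnique_gauge212 D hc x
  exact ⟨n₀, hn₀, ⟨by rw [QE_sub_dE D c x hn₀, hx], hR₀⟩⟩

/-! ## §3. The minimal orbit of (2.5) under (2.6) -/

/-- **a solution of the variational problem (2.5)–(2.6) as posed** (no gauge condition): `QA = B` and `‖∂A‖² ≤ ‖∂A′‖²` for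
every `A′` with `QA′ = B`. [cite: Balaban1984PropagatorsII, (2.5)–(2.6) p.224] -/
def IsMin25 (c : ℝ) (B : BondIdxSpace D) (x : BondSpace P) : Prop :=
  QE D x = B ∧ ∀ y : BondSpace P, QE D y = B → energy (dcE c) x ≤ energy (dcE c) y

/-- `IsMin25` is invariant along orbits. [cite: Balaban1984PropagatorsII, (2.5)–(2.7) p.224] -/
theorem isMin25_of_sameOrbit (c : ℝ) {B : BondIdxSpace D} {x y : BondSpace P} (hx : IsMin25 D c B x)
    (h : SameOrbit D c x y) : IsMin25 D c B y :=
  ⟨(QE_eq_of_sameOrbit D c h).trans hx.1, fun z hz => (energy_eq_of_sameOrbit D c h).le.trans (hx.2 z hz)⟩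

/-- `Q(HB) = B`: the configuration (2.35) satisfies (2.6) (gen 5's `isCritical_hOp_V1`). [cite: Balaban1984PropagatorsII, (2.35) p.228] -/
theorem QE_hOp {c : ℝ} (hc : c ≠ 0) {w : BondIdx D → ℝ} (hw : ∀ i, 0 < w i) (B : BondIdxSpace D) :
    QE D (B6SectA.hOp (GE D hc hw) (QsE D) (EE D hc hw) B) = B :=
  (isCritical_hOp_V1 D hc hw B).1.1

/-- `R∂*(HB) = 0`: (2.35) satisfies the gauge condition (2.12). [cite: Balaban1984PropagatorsII, (2.12) p.225 + (2.35) p.228] -/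
theorem RE_dsE_hOp {c : ℝ} (hc : c ≠ 0) {w : BondIdx D → ℝ} (hw : ∀ i, 0 < w i) (B : BondIdxSpace D) :
    RE D c (dsE c (B6SectA.hOp (GE D hc hw) (QsE D) (EE D hc hw) B)) = 0 :=
  (isCritical_hOp_V1 D hc hw B).1.2

/-- **`HB` minimises (2.5) under (2.6) ALONE**: `‖∂(HB)‖² ≤ ‖∂A‖²` for EVERY `A` with `QA = B` (gauge-fix `A` inside its orbit,
§2, then gen 5's `energy_hOp_le_V1`; the energy is constant on the orbit). [cite: Balaban1984PropagatorsII, (2.5)–(2.6) p.224 + p.226 before (2.18)] -/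
theorem energy_hOp_le_of_constr {c : ℝ} (hc : c ≠ 0) {w : BondIdx D → ℝ} (hw : ∀ i, 0 < w i) {B : BondIdxSpace D}
    {y : BondSpace P} (hy : QE D y = B) :
    energy (dcE c) (B6SectA.hOp (GE D hc hw) (QsE D) (EE D hc hw) B) ≤ energy (dcE c) y := by
  obtain ⟨n, _, hadm⟩ := admissible_gaugeFix D hc hy
  exact (energy_hOp_le_V1 D hc hw B hadm).trans (energy_sub_dE c y n).le

/-- hence `HB` IS a solution of (2.5)–(2.6) (*"which is of course, a minimum of the functional (2.5)"*, p. 226).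
[cite: Balaban1984PropagatorsII, p.226 before (2.18) + (2.35) p.228] -/
theorem isMin25_hOp {c : ℝ} (hc : c ≠ 0) {w : BondIdx D → ℝ} (hw : ∀ i, 0 < w i) (B : BondIdxSpace D) :
    IsMin25 D c B (B6SectA.hOp (GE D hc hw) (QsE D) (EE D hc hw) B) :=
  ⟨QE_hOp D hc hw B, fun _ hy => energy_hOp_le_of_constr D hc hw hy⟩

/-- **a minimal orbit exists.** [cite: Balaban1984PropagatorsII, (2.5)–(2.7) p.224] -/
theorem exists_isMin25 {c : ℝ} (hc : c ≠ 0) (B : BondIdxSpace D) : ∃ x : BondSpace P, IsMin25 D c B x :=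
  ⟨_, isMin25_hOp D hc (fun _ : BondIdx D => one_pos) B⟩

/-- **THE MINIMAL ORBIT, PROVED**: a configuration solves the variational problem (2.5)–(2.6) IFF it lies on the orbit of
`HB = GQ*(QGQ*)⁻¹B` under the gauge group (2.7), i.e. `A = HB − ∂λ` for some `λ ∈ N(Q′)` (for every choice of the weights
`a > 0` in `H`).  (⇒: gauge-fix `A` to `A^{λ₀}` with `R∂*A^{λ₀} = 0`; it minimises (2.5) on the admissible set, hence is critical
(r03's `isCritical_of_isMinOn`), hence equals `HB` by gen 5's `isCritical_iff_eq_hOp`.)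
[cite: Balaban1984PropagatorsII, (2.5)–(2.7) p.224 + (2.35) p.228] -/
theorem isMin25_iff_mem_orbit {c : ℝ} (hc : c ≠ 0) {w : BondIdx D → ℝ} (hw : ∀ i, 0 < w i) (B : BondIdxSpace D)
    (x : BondSpace P) :
    IsMin25 D c B x ↔ SameOrbit D c (B6SectA.hOp (GE D hc hw) (QsE D) (EE D hc hw) B) x := by
  constructor
  · rintro ⟨hx, hmin⟩
    obtain ⟨n, hn, hadm⟩ := admissible_gaugeFix D hc hx
    have hmin' : ∀ y, Admissible (QE D) (dsE c) (RE D c) B y → energy (dcE c) (x - dE c n) ≤ energy (dcE c) y :=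
      fun y hy => (energy_sub_dE c x n).le.trans (hmin y hy.1)
    have hcrit : IsCritical (dcE c) (QE D) (dsE c) (RE D c) B (x - dE c n) :=
      B6Eq218Lagrangian.isCritical_of_isMinOn hadm hmin'
    have hxn : x - dE c n = B6SectA.hOp (GE D hc hw) (QsE D) (EE D hc hw) B := (isCritical_iff_eq_hOp D hc hw B _).mp hcrit
    exact ⟨-n, Submodule.neg_mem _ hn, by rw [← hxn, map_neg, sub_neg_eq_add, sub_add_cancel]⟩
  · exact fun h => isMin25_of_sameOrbit D c (isMin25_hOp D hc hw B) h

/-- **uniqueness of the minimal orbit**: any two solutions of (2.5)–(2.6) are gauge equivalent under (2.7).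
[cite: Balaban1984PropagatorsII, (2.5)–(2.7) p.224] -/
theorem sameOrbit_of_isMin25 {c : ℝ} (hc : c ≠ 0) {B : BondIdxSpace D} {x y : BondSpace P} (hx : IsMin25 D c B x)
    (hy : IsMin25 D c B y) : SameOrbit D c x y := by
  have hw : ∀ i : BondIdx D, 0 < (fun _ => (1 : ℝ)) i := fun _ => one_pos
  exact sameOrbit_trans D c (sameOrbit_symm D c ((isMin25_iff_mem_orbit D hc hw B x).mp hx))
    ((isMin25_iff_mem_orbit D hc hw B y).mp hy)

/-- the set of solutions of (2.5)–(2.6) IS the orbit `{HB − ∂λ : λ ∈ N(Q′)}`. [cite: Balaban1984PropagatorsII, (2.5)–(2.7) p.224 + (2.35) p.228] -/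
theorem setOf_isMin25_eq_orbit {c : ℝ} (hc : c ≠ 0) {w : BondIdx D → ℝ} (hw : ∀ i, 0 < w i) (B : BondIdxSpace D) :
    {x : BondSpace P | IsMin25 D c B x} =
      {x | ∃ n ∈ LinearMap.ker (QpE D), x = B6SectA.hOp (GE D hc hw) (QsE D) (EE D hc hw) B - dE c n} :=
  Set.ext fun x => isMin25_iff_mem_orbit D hc hw B x

/-! ## §4. (2.12) selects `HB` on the minimal orbit -/

/-- **a solution of (2.5)–(2.6) satisfying the gauge condition (2.12) is `HB`**, and conversely (every `a > 0`).
[cite: Balaban1984PropagatorsII, (2.12) p.225 + (2.35) p.228] -/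
theorem isMin25_and_gauge_iff {c : ℝ} (hc : c ≠ 0) {w : BondIdx D → ℝ} (hw : ∀ i, 0 < w i) (B : BondIdxSpace D)
    (x : BondSpace P) :
    IsMin25 D c B x ∧ RE D c (dsE c x) = 0 ↔ x = B6SectA.hOp (GE D hc hw) (QsE D) (EE D hc hw) B := by
  constructor
  · rintro ⟨hx, hR⟩
    have horb := (isMin25_iff_mem_orbit D hc hw B x).mp hx
    obtain ⟨y, -, huniq⟩ := existsUnique_gaugeFixed_in_orbit D hc (B6SectA.hOp (GE D hc hw) (QsE D) (EE D hc hw) B)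
    rw [huniq x ⟨horb, hR⟩, huniq _ ⟨sameOrbit_refl D c _, RE_dsE_hOp D hc hw B⟩]
  · rintro rfl
    exact ⟨isMin25_hOp D hc hw B, RE_dsE_hOp D hc hw B⟩

/-- ***"exactly one"***: the variational problem (2.5)–(2.6) with the gauge condition (2.12) has EXACTLY ONE solution (and it
is `HB`, `isMin25_and_gauge_iff`) — the minimal orbit meets the gauge slice once. [cite: Balaban1984PropagatorsII, (2.12) p.225 + p.226 before (2.18) + (2.35) p.228] -/
theorem existsUnique_isMin25_gauge {c : ℝ} (hc : c ≠ 0) (B : BondIdxSpace D) :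
    ∃! x : BondSpace P, IsMin25 D c B x ∧ RE D c (dsE c x) = 0 := by
  have hw : ∀ i : BondIdx D, 0 < (fun _ => (1 : ℝ)) i := fun _ => one_pos
  exact ⟨_, (isMin25_and_gauge_iff D hc hw B _).mpr rfl, fun x hx => (isMin25_and_gauge_iff D hc hw B x).mp hx⟩

/-- the solutions of the gauge-fixed problem ((2.6) ∧ (2.12), gen 5) and of the problem as posed ((2.6) alone) have the same
minimal value `‖∂(HB)‖²`. [cite: Balaban1984PropagatorsII, (2.5)–(2.6) p.224 + (2.12) p.225] -/
theorem isMin25_energy_eq {c : ℝ} (hc : c ≠ 0) {w : BondIdx D → ℝ} (hw : ∀ i, 0 < w i) {B : BondIdxSpace D}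
    {x : BondSpace P} (hx : IsMin25 D c B x) :
    energy (dcE c) x = energy (dcE c) (B6SectA.hOp (GE D hc hw) (QsE D) (EE D hc hw) B) :=
  energy_eq_of_sameOrbit D c ((isMin25_iff_mem_orbit D hc hw B x).mp hx)

end

end Literature.MathematicalPhysics.QuantumFieldTheory.Balaban1983to89.B6MinimalOrbitV1
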